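import Summits.BirchSwinnertonDyer.Rank1Residual.GaloisImage.KolyvaginPrimeTransverse
import Literature.NumberTheory.GaloisRepresentations.DecompositionGroupOfCompletion
import Literature.NumberTheory.GaloisRepresentations.RestrictedRamification
import Literature.NumberTheory.GaloisRepresentations.CyclotomicLevels
import Literature.NumberTheory.GaloisRepresentations.TateLevelOneWildOdd
import Literature.NumberTheory.EllipticCurves.KummerSelmerStructure
import HarnessLib

/-!
# K6 crux `MuTransferX9` (stmt-BirchSwinnertonDyer-19276), skeleton v6 stub `stub_stepsTwoFourOdd`:
# the LOCAL reading of the Kolyvagin cocycle's transversality — a global cocycle vanishing on the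
# elements of `Gal(K̄/K(μ_ℓ))` that normalise the inertia group of the distinguished prime `𝔓₀ ∣ v`
# has `loc_v [Φ] ∈ H¹_tr(K_v, M)` (the `K_v(μ_ℓ)`-transverse subgroup)

Cell `bsd-smallim`, seat `bsd-smallim-k6-g3` (gen 0).  THEOREMS ONLY (no definition, no named fact,
no `sorry`); generic over a number field `K` and a discrete module (serves X9 `p ∈ {5,7}` and X10b
`p = 3` alike).  HONEST FRAMING: helper toward the registered stub (the clause "`loc_q κ_q ∈ H¹_tr`"
of the G3/G4 meeting point, x10 p454438 `StepFour.convCoeff_eq_zero_of_qTermIdentity`); closes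
nothing.  PARTITION (D-0054): X9 (A4) · X10b (A5) — helper; closes NONE.

The dictionary step between my GLOBAL output and koly's / x10's LOCAL currency.
`KolyvaginTwist.exists_kolyvaginCocycle_rat` (p454778) delivers a global cocycle `Φ : Γ_ℚ → 𝒯_J`
vanishing at every `φ ∈ N = Gal(ℚ̄/ℚ(μ_ℓ))` that NORMALISES `ℐ_𝔔` (for any prime `𝔔 ∣ q`).  Taking
`𝔔 = 𝔓₀ = adicCompletionPrime K v`, the prime cut out by the chosen embedding `K̄ → \bar K_v`
(tree `DecompositionGroupOfCompletion`): every `res g`, `g ∈ Γ_{K_v}`, stabilises `𝔓₀`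
(`absGaloisRestrict_smul_eq_of_forall_mem_iff`), hence normalises `ℐ_{𝔓₀}`
(`conj_mem_inertia_smul`); and `res g ∈ N` iff `χ̄_ℓ(g) = 1` for the LOCAL mod-`ℓ` cyclotomic
character (`modNCyclotomicCharacter_absGaloisRestrict`, `rootsOfUnityFixer_eq_ker`).  So `Φ ∘ res`
vanishes on `ker χ̄_ℓ = Gal(\bar K_v/K_v(μ_ℓ))`, i.e. (b2b `mem_transverseSubgroup_cyclotomicField_iff`)
**`loc_v [Φ] ∈ DiscreteGaloisModule.transverseSubgroup (GaloisRep.toLocal v ρ) (CyclotomicField ℓ K_v)`**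
— koly's `H¹_tr` (`…X9LocalTransverse`), the hypothesis "`[c] ∈ H¹_tr`" of the meeting point.

* `absGaloisRestrict_normalises_inertia_adicCompletionPrime` — `(res g)⁻¹ ℐ_{𝔓₀} (res g) ⊆ ℐ_{𝔓₀}`;
* `absGaloisRestrict_mem_rootsOfUnityFixer_of` — `χ̄_ℓ^{K_v}(g) = 1 ⟹ res g ∈ Gal(K̄/K(μ_ℓ))`;
* **`localization_mem_transverseSubgroup_of_forall_apply_eq_zero`** — the transversality;
* `apply_absGaloisRestrict_eq_zero_of` — pointwise: `Φ(res g) = 0` for `χ̄_ℓ(g) = 1` (the form in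
  which x10's `hQ` evaluates `c.1 (res τq)`-type terms on `Gal(\bar K_v/K_v(μ_ℓ))`).

References: J. Neukirch, *Algebraic Number Theory* (1999) II §9 (9.6) [NeukirchANT1999]; K. Rubin,
*Euler systems and Kolyvagin systems* (PCMI 2011) Def. 1.9.4 [Rubin2011]; B. Mazur, K. Rubin,
*Kolyvagin systems* (2004) Def. 1.1.6 [MazurRubin2004]; HOME/koly/MU-TRANSFER-PROOF.md §3 Lemma 2
("TRANSVERSE at `q` (`res_{𝒟∩H} loc_q κ_q = 0`)").
-/

-- the summit and its single problem are both named `BirchSwinnertonDyer` (registry layout D-0017)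
set_option linter.dupNamespace false
set_option autoImplicit false

noncomputable section

open CategoryTheory Function
open scoped NumberField Pointwise
open Field IsDedekindDomain NumberField
open Literature.NumberTheory.GaloisRepresentations
open Summit.BirchSwinnertonDyer.Rank1Residual.GaloisImage

universe u

namespace Summit.BirchSwinnertonDyer.BirchSwinnertonDyer.Rank1Residual.KolyvaginTwist

variable {K : Type u} [Field K] [NumberField K] {M : Type u} [AddCommGroup M] [TopologicalSpace M]
  [DiscreteTopology M] (ρ : DiscreteGaloisModule K M) (v : HeightOneSpectrum (𝓞 K))

/-- **Local elements normalise the inertia group of the distinguished prime**: for `g ∈ Γ_{K_v}`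
and `τ ∈ ℐ_{𝔓₀}` (`𝔓₀ = adicCompletionPrime K v`), `(res g)⁻¹ τ (res g) ∈ ℐ_{𝔓₀}` — since
`res g⁻¹ • 𝔓₀ = 𝔓₀` and `σ ℐ_𝔓 σ⁻¹ = ℐ_{σ•𝔓}`. [cite: NeukirchANT1999, Ch. II §9 Prop. (9.6)] -/
theorem absGaloisRestrict_normalises_inertia_adicCompletionPrime
    (g : absoluteGaloisGroup (v.adicCompletion K)) {τ : absoluteGaloisGroup K}
    (hτ : τ ∈ (adicCompletionPrime K v).inertia (absoluteGaloisGroup K)) :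
    (absGaloisRestrict K (v.adicCompletion K) g)⁻¹ * τ * absGaloisRestrict K (v.adicCompletion K) g ∈
      (adicCompletionPrime K v).inertia (absoluteGaloisGroup K) := by
  -- `res g⁻¹` lies in the decomposition group of `𝔓₀`, i.e. stabilises `𝔓₀`
  have hmem : absGaloisRestrict K (v.adicCompletion K) g⁻¹ ∈
      (adicCompletionPrime K v).decompositionSubgroup (absoluteGaloisGroup K) := by
    rw [decompositionSubgroup_adicCompletionPrime_eq_range]
    exact ⟨g⁻¹, rfl⟩
  have hfix := Ideal.mem_decompositionSubgroup_iff.mp hmem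
  have h := conj_mem_inertia_smul hτ (absGaloisRestrict K (v.adicCompletion K) g⁻¹)
  rw [hfix, map_inv, inv_inv] at h
  exact h

/-- **`χ̄_ℓ^{K_v}(g) = 1 ⟹ res g ∈ Gal(K̄/K(μ_ℓ))`**: the local and global mod-`ℓ` cyclotomic
characters agree along `res` (`modNCyclotomicCharacter_absGaloisRestrict`) and `Gal(K̄/K(μ_ℓ))` is the
kernel of the global one (`rootsOfUnityFixer_eq_ker`). [cite: NeukirchANT1999, Ch. II §9 Prop. (9.6)] -/
theorem absGaloisRestrict_mem_rootsOfUnityFixer_of (ℓ : ℕ) [Fact ℓ.Prime]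
    [NeZero (ℓ : v.adicCompletion K)] {g : absoluteGaloisGroup (v.adicCompletion K)}
    (hg : modPCyclotomicCharacterZMod (v.adicCompletion K) ℓ g = 1) :
    absGaloisRestrict K (v.adicCompletion K) g ∈ rootsOfUnityFixer K ℓ := by
  haveI : NeZero ℓ := ⟨(Fact.out : ℓ.Prime).ne_zero⟩
  haveI : NeZero (ℓ : K) := ⟨Nat.cast_ne_zero.mpr (Fact.out : ℓ.Prime).ne_zero⟩
  rw [rootsOfUnityFixer_eq_ker, MonoidHom.mem_ker, modNCyclotomicCharacter_absGaloisRestrict]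
  rw [modPCyclotomicCharacterZMod_eq_modNCyclotomicCharacter] at hg
  exact hg

/-- **A global cocycle vanishing on the `ℐ_{𝔓₀}`-normalising elements of `Gal(K̄/K(μ_ℓ))` vanishes
on `res (ker χ̄_ℓ^{K_v})`**, pointwise. [cite: Rubin2011, Def. 1.9.4 (p. 14)] -/
theorem apply_absGaloisRestrict_eq_zero_of (ℓ : ℕ) [Fact ℓ.Prime] [NeZero (ℓ : v.adicCompletion K)]
    (Φ : contOneCocycles ρ.toTopRep)
    (hΦ : ∀ g ∈ rootsOfUnityFixer K ℓ,
      (∀ τ ∈ (adicCompletionPrime K v).inertia (absoluteGaloisGroup K),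
        g⁻¹ * τ * g ∈ (adicCompletionPrime K v).inertia (absoluteGaloisGroup K)) → Φ.1 g = 0)
    {g : absoluteGaloisGroup (v.adicCompletion K)}
    (hg : modPCyclotomicCharacterZMod (v.adicCompletion K) ℓ g = 1) :
    Φ.1 (absGaloisRestrict K (v.adicCompletion K) g) = 0 :=
  hΦ _ (absGaloisRestrict_mem_rootsOfUnityFixer_of v ℓ hg)
    fun _ hτ => absGaloisRestrict_normalises_inertia_adicCompletionPrime v g hτ

/-- **MU-TRANSFER-PROOF §3 Lemma 2, "transverse at `q`", in the LOCAL currency.**  Let `Φ` be a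
global continuous cocycle of the discrete `Γ_K`-module `ρ` which vanishes at every
`g ∈ Gal(K̄/K(μ_ℓ))` normalising the inertia group `ℐ_{𝔓₀}` of the distinguished prime
`𝔓₀ = adicCompletionPrime K v` (for the Kolyvagin cocycle of `KolyvaginTwist.exists_kolyvaginCocycle_rat`
this is its last clause with `𝔔 := 𝔓₀`).  Then the localisation `loc_v [Φ] ∈ H¹(K_v, M)` lies in
the `K_v(μ_ℓ)`-TRANSVERSE subgroup `H¹_tr = ker (H¹(K_v, M) → H¹(K_v(μ_ℓ), M))`
(b2b `mem_transverseSubgroup_cyclotomicField_iff`: principal — here zero — on `ker χ̄_ℓ`).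
[cite: Rubin2011, Def. 1.9.4 (p. 14)] [cite: MazurRubin2004, Def. 1.1.6] -/
theorem localization_mem_transverseSubgroup_of_forall_apply_eq_zero (ℓ : ℕ) [Fact ℓ.Prime]
    [NeZero (ℓ : v.adicCompletion K)] (Φ : contOneCocycles ρ.toTopRep)
    (hΦ : ∀ g ∈ rootsOfUnityFixer K ℓ,
      (∀ τ ∈ (adicCompletionPrime K v).inertia (absoluteGaloisGroup K),
        g⁻¹ * τ * g ∈ (adicCompletionPrime K v).inertia (absoluteGaloisGroup K)) → Φ.1 g = 0) :
    galoisCohomology.localization ρ (Sum.inr v) 1 (oneCocycleClass ρ.toTopRep Φ) ∈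
      DiscreteGaloisModule.transverseSubgroup (GaloisRep.toLocal v ρ)
        (CyclotomicField ℓ (v.adicCompletion K)) := by
  have hloc : galoisCohomology.localization ρ (Sum.inr v) 1 (oneCocycleClass ρ.toTopRep Φ) =
      oneCocycleClass (GaloisRep.toLocal v ρ).toTopRep
        (contOneCocycles.pullback (absGaloisRestrict K (v.adicCompletion K)) (X := ρ.toTopRep)
          (Y := (GaloisRep.toLocal v ρ).toTopRep)
          (TopRep.ofHom ⟨ContinuousLinearMap.id ℤ M, fun _ => rfl⟩) Φ) :=
    galoisCohomology.res_one_oneCocycleClass (v.adicCompletion K) Φ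
  have key : oneCocycleClass (GaloisRep.toLocal v ρ).toTopRep
        (contOneCocycles.pullback (absGaloisRestrict K (v.adicCompletion K)) (X := ρ.toTopRep)
          (Y := (GaloisRep.toLocal v ρ).toTopRep)
          (TopRep.ofHom ⟨ContinuousLinearMap.id ℤ M, fun _ => rfl⟩) Φ) ∈
      DiscreteGaloisModule.transverseSubgroup (GaloisRep.toLocal v ρ)
        (CyclotomicField ℓ (v.adicCompletion K)) := by
    rw [mem_transverseSubgroup_cyclotomicField_iff]
    refine ⟨0, fun g hg => ?_⟩
    rw [contOneCocycles.pullback_apply, map_zero, sub_zero]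
    exact apply_absGaloisRestrict_eq_zero_of ρ v ℓ Φ hΦ hg
  exact hloc ▸ key

end Summit.BirchSwinnertonDyer.BirchSwinnertonDyer.Rank1Residual.KolyvaginTwist

end
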